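import Literature.Computability.Complexity.DnfOfCopies
import Literature.Computability.Complexity.GateValueConsistency
import HarnessLib

/-!
# The `EVAL-GATE` consistency circuit: unsatisfiable iff the claimed gate values are correct

Literature / circuit complexity toolkit, the circuit-level core of the verification of a
guessed evaluation circuit in the algorithms-to-lower-bounds simulations (R. Williams, J. ACM
2014, Lemma 3.1, pp. 10–12: the circuits VALUE and EQUIV; C. D. Murray, R. R. Williams, STOC
2018, §5, proof of Thm. 1.1/1.2: "`N` guesses a `C`-circuit `E` computing EVAL-GATE … For each
gate `i` of `C_n^{W_n}`, let `i₁, i₂ < i` be the indices of the two gates … whose outputs are the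
two inputs to gate `i`. Let `Fᵢ(gᵢ, g_{i₁}, g_{i₂})` be the canonical 3-CNF … which is true if and
only if the outputs of gates `i₁` and `i₂` are consistent with the output of gate `i`. Now
consider the circuit `D = ¬⋀ᵢ Fᵢ(E(C,W,x,i), E(C,W,x,i₁), E(C,W,x,i₂))`. It is easy to see that
`D(x) = 0` if and only if `E` is consistent for all gates of `C_n^{W_n}` on the input `x` …
From this, we have the consistency condition: for all `x`, `D(x) = 0` implies that
`E(C_n^O, W_n, x, s) = C_n^{W_n}(x)`" (6)).

Setting (all data explicit, the addressing abstract): a circuit `G : Circuit (Fin ℓ)` to be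
evaluated (any basis; the construction enumerates the `2^{arity}` assignments of the arguments
of each gate, so it is meant for bounded fan-in, e.g. `B₂`); a *claimed-value circuit*
`E : Circuit (Fin N)` queried about gate `j` at input `r` through a re-addressing
`σ j : Fin N → Fin ℓ ⊕ Bool` of its inputs (inputs of `E` read the bits of `r` or hard-wired
constants coding `j`; `claim E σ r j = E(r ∘ σ j)`); and, for the input wires of `G`, literal
providers `Pin i = (P, τ)` with `P(r ∘ τ) = r i` (e.g. the gate-free circuit `Circuit.input k₀`
re-addressed so that its input `k₀` reads `r i`). Then:

* `wireLit`, `gatePats`, **`consistencyPats G E σ Pin`** — the patterns of the consistency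
  circuit: for every gate `j` of `G` (gate function `op`, argument wires `args`) and every
  assignment `u` of its arguments, the conjunction "every argument wire `args b` carries `u b`
  (as claimed by `E`, or as read off `r` for an input wire) and `E` claims `¬ op(u)` for gate
  `j`" — exactly the clauses of `¬Fⱼ`; the consistency circuit is
  `Circuit.dnfOfLits (consistencyPats G E σ Pin)` (`DnfOfCopies.lean`: depth `≤ d + 3`, size
  and fan-in bounds from those of `E` and the `Pin i`);
* **`not_satisfiable_consistency_iff`** — **proved**: the consistency circuit is UNSATISFIABLE
  iff for every input `r` and every gate `j` of `G`, the claim `E(r ∘ σ j)` is the true value of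
  gate `j` of `G` at `r` (`Circuit.wireVals`). Soundness is `GateList.vals_eq_of_consistent`
  (locally consistent claims are the true values, `GateValueConsistency.lean`), completeness is
  `GateList.vals_consistent`;
* **`eval_eq_claim_output_of_not_satisfiable`** — in particular the claim for the output gate
  is `G(r)` (the consistency condition (6));
* bookkeeping for the resource analysis: `length_consistencyPats_le`
  (`≤ G.size · 2^{G.maxFanIn}` patterns), `length_le_of_mem_consistencyPats` (`≤ G.maxFanIn + 1`
  literals each), `circuit_mem_of_mem_consistencyPats` (every literal circuit is `E` or some
  `(Pin i).1`).

Everything lives in the namespace `EvalGate`. No named fact is introduced (definitions with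
their proved properties only).

## References

* C. D. Murray, R. R. Williams, *Circuit lower bounds for nondeterministic quasi-polytime: an easy
  witness lemma for NP and NQP*, STOC 2018, §5 (EVAL-GATE, the circuit `D`, condition (6))
  [MurrayWilliams2018].
* R. Williams, *Nonuniform ACC circuit lower bounds*, J. ACM 61 (2014), Lemma 3.1 (VALUE,
  EQUIV), proof of Thm. 3.2 [Williams2014].
-/

namespace Literature.Computability.Complexity

namespace EvalGate

open GateList MetaComplexity

variable {ℓ N : ℕ}

/-! ### Claims and literals -/

/-- The value CLAIMED by `E` for gate `j` of the evaluated circuit at input `r`: `E` evaluated on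
its inputs re-addressed by `σ j` (bits of `r` or constants). [cite: MurrayWilliams2018, §5 (proof of Thm. 1.1)] -/
def claim (E : Circuit (Fin N)) (σ : ℕ → Fin N → Fin ℓ ⊕ Bool) (r : Fin ℓ → Bool) (j : ℕ) : Bool :=
  E.eval fun k => Sum.elim r id (σ j k)

/-- The claimed value of a wire: an input wire carries its input bit, a gate wire its claim.
[cite: MurrayWilliams2018, §5 (proof of Thm. 1.1)] -/
def claimOf (E : Circuit (Fin N)) (σ : ℕ → Fin N → Fin ℓ ⊕ Bool) (r : Fin ℓ → Bool) :
    Fin ℓ ⊕ ℕ → Bool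
  | .inl i => r i
  | .inr j => claim E σ r j

/-- A literal of the consistency circuit is *satisfied* at `r` if its circuit, re-addressed,
evaluates to its polarity (the semantics of `Circuit.dnfOfLits`). [folklore] -/
def LitSat (r : Fin ℓ → Bool) (q : Circuit (Fin N) × (Fin N → Fin ℓ ⊕ Bool) × Bool) : Prop :=
  q.1.eval (fun k => Sum.elim r id (q.2.1 k)) = q.2.2

/-- The literal "wire `w` carries `c`": for a gate wire the claimed-value circuit `E` addressed
at that gate, for an input wire the literal provider `Pin i`. [cite: MurrayWilliams2018, §5 (proof of Thm. 1.1)] -/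
def wireLit (E : Circuit (Fin N)) (σ : ℕ → Fin N → Fin ℓ ⊕ Bool)
    (Pin : Fin ℓ → Circuit (Fin N) × (Fin N → Fin ℓ ⊕ Bool)) (w : Fin ℓ ⊕ ℕ) (c : Bool) :
    Circuit (Fin N) × (Fin N → Fin ℓ ⊕ Bool) × Bool :=
  match w with
  | .inl i => ((Pin i).1, (Pin i).2, c)
  | .inr j => (E, σ j, c)

variable (E : Circuit (Fin N)) (σ : ℕ → Fin N → Fin ℓ ⊕ Bool)
  (Pin : Fin ℓ → Circuit (Fin N) × (Fin N → Fin ℓ ⊕ Bool))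

/-- **Semantics of a wire literal**: satisfied iff the claimed value of the wire is the polarity
(input literals through the correctness `P(r ∘ τ) = r i` of the providers). [cite: MurrayWilliams2018, §5 (proof of Thm. 1.1)] -/
theorem litSat_wireLit_iff (hPin : ∀ (r : Fin ℓ → Bool) (i : Fin ℓ),
      (Pin i).1.eval (fun k => Sum.elim r id ((Pin i).2 k)) = r i)
    (r : Fin ℓ → Bool) (w : Fin ℓ ⊕ ℕ) (c : Bool) :
    LitSat r (wireLit E σ Pin w c) ↔ claimOf E σ r w = c := by
  cases w with
  | inl i => simp [LitSat, wireLit, claimOf, hPin]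
  | inr j => rfl

/-! ### The patterns of the consistency circuit -/

/-- The patterns of gate `j` with gate `g`: for each assignment `u` of its arguments (in the
order of `boolFunEquivFin`), "the arguments carry `u` and the claim for `j` is `¬ g.op u`".
[cite: MurrayWilliams2018, §5 (proof of Thm. 1.1)] -/
def gatePats (j : ℕ) (g : Gate (Fin ℓ)) :
    List (List (Circuit (Fin N) × (Fin N → Fin ℓ ⊕ Bool) × Bool)) :=
  List.ofFn fun a : Fin (2 ^ g.arity) =>
    (List.ofFn fun b : Fin g.arity =>
        wireLit E σ Pin (g.args b) ((boolFunEquivFin g.arity).symm a b)) ++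
      [(E, σ j, !(g.op ((boolFunEquivFin g.arity).symm a)))]

/-- **The patterns of the consistency circuit of `G`**: those of all its gates.
[cite: MurrayWilliams2018, §5 (proof of Thm. 1.1)] -/
def consistencyPats (G : Circuit (Fin ℓ)) :
    List (List (Circuit (Fin N) × (Fin N → Fin ℓ ⊕ Bool) × Bool)) :=
  (List.finRange G.size).flatMap fun j => gatePats E σ Pin j.1 (G.gates[j.1]'j.2)

variable (G : Circuit (Fin ℓ))

/-- Membership in the patterns: a gate `j` of `G` and an assignment of its arguments. [folklore] -/
theorem mem_consistencyPats_iff (p : List (Circuit (Fin N) × (Fin N → Fin ℓ ⊕ Bool) × Bool)) :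
    p ∈ consistencyPats E σ Pin G ↔ ∃ (j : Fin G.size) (a : Fin (2 ^ (G.gates[j.1]'j.2).arity)),
      p = (List.ofFn fun b : Fin (G.gates[j.1]'j.2).arity =>
            wireLit E σ Pin ((G.gates[j.1]'j.2).args b)
              ((boolFunEquivFin (G.gates[j.1]'j.2).arity).symm a b)) ++
          [(E, σ j.1, !((G.gates[j.1]'j.2).op ((boolFunEquivFin (G.gates[j.1]'j.2).arity).symm a)))] := by
  simp only [consistencyPats, List.mem_flatMap, List.mem_finRange, true_and, gatePats,
    List.mem_ofFn]
  constructor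
  · rintro ⟨j, a, rfl⟩
    exact ⟨j, a, rfl⟩
  · rintro ⟨j, a, rfl⟩
    exact ⟨j, a, rfl⟩

/-- The literals of one pattern are all satisfied iff the arguments carry the assignment (as
claimed) and the claim for the gate is the negated gate value. [folklore] -/
theorem forall_litSat_pattern_iff (hPin : ∀ (r : Fin ℓ → Bool) (i : Fin ℓ),
      (Pin i).1.eval (fun k => Sum.elim r id ((Pin i).2 k)) = r i)
    (r : Fin ℓ → Bool) (j : ℕ) (g : Gate (Fin ℓ)) (u : Fin g.arity → Bool) :
    (∀ q ∈ (List.ofFn fun b : Fin g.arity => wireLit E σ Pin (g.args b) (u b)) ++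
        [(E, σ j, !(g.op u))], LitSat r q) ↔
      (∀ b, claimOf E σ r (g.args b) = u b) ∧ claim E σ r j = !(g.op u) := by
  rw [List.forall_mem_append, List.forall_mem_ofFn_iff, List.forall_mem_singleton]
  simp only [litSat_wireLit_iff E σ Pin hPin]
  rfl

/-! ### Bookkeeping -/

/-- There are at most `G.size · 2^{G.maxFanIn}` patterns. [folklore] -/
theorem length_consistencyPats_le :
    (consistencyPats E σ Pin G).length ≤ G.size * 2 ^ G.maxFanIn := by
  unfold consistencyPats
  rw [List.length_flatMap]
  calc ((List.finRange G.size).map fun j => (gatePats E σ Pin j.1 (G.gates[j.1]'j.2)).length).sum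
      ≤ ((List.finRange G.size).map fun _ => 2 ^ G.maxFanIn).sum := by
        refine List.sum_le_sum fun j _ => ?_
        simp only [gatePats, List.length_ofFn]
        exact Nat.pow_le_pow_right two_pos
          ((Circuit.maxFanIn_le_iff G _).1 le_rfl _ (List.getElem_mem _))
    _ = G.size * 2 ^ G.maxFanIn := by
        simp only [List.map_const', List.sum_replicate, smul_eq_mul, List.length_finRange]

/-- Every pattern has at most `G.maxFanIn + 1` literals. [folklore] -/
theorem length_le_of_mem_consistencyPats
    {p : List (Circuit (Fin N) × (Fin N → Fin ℓ ⊕ Bool) × Bool)}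
    (hp : p ∈ consistencyPats E σ Pin G) : p.length ≤ G.maxFanIn + 1 := by
  obtain ⟨j, a, rfl⟩ := (mem_consistencyPats_iff E σ Pin G p).1 hp
  simp only [List.length_append, List.length_ofFn, List.length_singleton]
  exact Nat.add_le_add_right ((Circuit.maxFanIn_le_iff G _).1 le_rfl _ (List.getElem_mem _)) 1

/-- Every literal circuit is the claimed-value circuit `E` or one of the input providers.
[folklore] -/
theorem circuit_mem_of_mem_consistencyPats
    {p : List (Circuit (Fin N) × (Fin N → Fin ℓ ⊕ Bool) × Bool)}
    (hp : p ∈ consistencyPats E σ Pin G) {q : Circuit (Fin N) × (Fin N → Fin ℓ ⊕ Bool) × Bool}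
    (hq : q ∈ p) : q.1 = E ∨ ∃ i, q.1 = (Pin i).1 := by
  obtain ⟨j, a, rfl⟩ := (mem_consistencyPats_iff E σ Pin G p).1 hp
  rw [List.mem_append, List.mem_ofFn, List.mem_singleton] at hq
  rcases hq with ⟨b, rfl⟩ | rfl
  · cases (G.gates[j.1]'j.2).args b with
    | inl i => exact Or.inr ⟨i, rfl⟩
    | inr j' => exact Or.inl rfl
  · exact Or.inl rfl

/-! ### Unsatisfiable iff the claims are the true values -/

/-- The list of the claims for all gates of `G` at `r`. [folklore] -/
def claimVals (r : Fin ℓ → Bool) : List Bool := List.ofFn fun j : Fin G.size => claim E σ r j.1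

/-- The claimed value of a wire into the first `G.size` gates is read off `claimVals`.
[folklore] -/
theorem wireOf_claimVals (r : Fin ℓ → Bool) (w : Fin ℓ ⊕ ℕ) (hw : ∀ m, w = .inr m → m < G.size) :
    wireOf r (claimVals E σ G r) w = claimOf E σ r w := by
  cases w with
  | inl i => rfl
  | inr m =>
    have hm := hw m rfl
    simp only [wireOf_inr, claimOf, claimVals, List.getD_eq_getElem?_getD, List.getElem?_ofFn,
      dif_pos hm, Option.getD_some]

/-- **The consistency circuit is unsatisfiable iff every claim is correct** (Murray–Williams
2018, §5: "`D(x) = 0` if and only if `E` is consistent for all gates … on the input `x`",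
together with: consistent claims are the true values, `GateList.vals_eq_of_consistent`, and the
true values are consistent, `GateList.vals_consistent`). Hypothesis: the input-literal
providers are correct. [cite: MurrayWilliams2018, §5 (proof of Thm. 1.1)] -/
theorem not_satisfiable_consistency_iff (hPin : ∀ (r : Fin ℓ → Bool) (i : Fin ℓ),
      (Pin i).1.eval (fun k => Sum.elim r id ((Pin i).2 k)) = r i) :
    ¬ (Circuit.dnfOfLits (consistencyPats E σ Pin G)).Satisfiable ↔
      ∀ (r : Fin ℓ → Bool) (j : ℕ), j < G.size → (G.wireVals r)[j]? = some (claim E σ r j) := by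
  rw [Circuit.not_satisfiable_dnfOfLits_iff]
  constructor
  · -- soundness: no pattern fires ⟹ the claims are consistent ⟹ they are the true values
    intro hD r j hj
    have hcons : ∀ (j : ℕ) (g : Gate (Fin ℓ)), G.gates[j]? = some g →
        (claimVals E σ G r)[j]? = some (g.op fun a => wireOf r (claimVals E σ G r) (g.args a)) := by
      intro j g hjg
      obtain ⟨hjl, hgj⟩ := List.getElem?_eq_some_iff.1 hjg
      have hvs : (claimVals E σ G r)[j]? = some (claim E σ r j) := by
        simp only [claimVals, List.getElem?_ofFn, dif_pos (show j < G.size from hjl)]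
      rw [hvs, Option.some.injEq]
      -- the arguments of gate `j` are inputs or earlier gates
      have hargs : ∀ b, wireOf r (claimVals E σ G r) (g.args b) = claimOf E σ r (g.args b) :=
        fun b => wireOf_claimVals E σ G r (g.args b) fun m hm =>
          ((wf_gates G) j g hjg b m hm).trans hjl
      simp only [hargs]
      -- if the claim for `j` were wrong, the pattern `(j, claimed arguments)` would fire
      by_contra hne
      set u : Fin g.arity → Bool := fun b => claimOf E σ r (g.args b) with hu
      have hfire : ∀ q ∈ (List.ofFn fun b : Fin g.arity => wireLit E σ Pin (g.args b) (u b)) ++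
          [(E, σ j, !(g.op u))], LitSat r q := by
        rw [forall_litSat_pattern_iff E σ Pin hPin]
        refine ⟨fun b => rfl, ?_⟩
        revert hne
        cases claim E σ r j <;> cases g.op u <;> simp
      have hmem : (List.ofFn fun b : Fin g.arity => wireLit E σ Pin (g.args b) (u b)) ++
          [(E, σ j, !(g.op u))] ∈ consistencyPats E σ Pin G := by
        rw [mem_consistencyPats_iff]
        subst hgj
        refine ⟨⟨j, hjl⟩, boolFunEquivFin _ u, ?_⟩
        simp only [Equiv.symm_apply_apply]
        rfl
      obtain ⟨q, hq, hviol⟩ := hD r _ hmem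
      exact hviol (hfire q hq)
    have hlen : (claimVals E σ G r).length = G.gates.length := by simp [claimVals, Circuit.size]
    have heq := vals_eq_of_consistent G.gates (wf_gates G) r (claimVals E σ G r) hlen hcons
    rw [circuit_wireVals, ← heq]
    simp only [claimVals, List.getElem?_ofFn, dif_pos hj]
  · -- completeness: correct claims violate some literal of every pattern
    intro h r p hp
    obtain ⟨j, a, rfl⟩ := (mem_consistencyPats_iff E σ Pin G p).1 hp
    by_contra hall
    push Not at hall
    obtain ⟨hargs, hj⟩ := (forall_litSat_pattern_iff E σ Pin hPin r j.1 (G.gates[j.1]'j.2)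
      ((boolFunEquivFin (G.gates[j.1]'j.2).arity).symm a)).1 fun q hq => hall q hq
    -- the true value of gate `j` is `op` of the true values of its arguments
    have hgj : G.gates[j.1]? = some (G.gates[j.1]'j.2) := List.getElem?_eq_getElem j.2
    have htrue := vals_consistent G.gates (wf_gates G) r j.1 _ hgj
    have hcl := h r j.1 j.2
    rw [circuit_wireVals] at hcl
    rw [hcl, Option.some.injEq] at htrue
    -- and the true values of the arguments are the claimed ones
    have hargs' : ∀ b, wireOf r (vals G.gates r) ((G.gates[j.1]'j.2).args b) =
        (boolFunEquivFin (G.gates[j.1]'j.2).arity).symm a b := by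
      intro b
      rw [← hargs b]
      cases hw : (G.gates[j.1]'j.2).args b with
      | inl i => rfl
      | inr m =>
        have hm : m < G.size := ((wf_gates G) j.1 _ hgj b m hw).trans j.2
        have hm' := h r m hm
        rw [circuit_wireVals] at hm'
        simp only [wireOf_inr, claimOf, List.getD_eq_getElem?_getD, hm', Option.getD_some]
    rw [show (fun b => wireOf r (vals G.gates r) ((G.gates[j.1]'j.2).args b)) =
        (boolFunEquivFin (G.gates[j.1]'j.2).arity).symm a from funext hargs'] at htrue
    rw [htrue] at hj
    revert hj
    cases (G.gates[j.1]'j.2).op ((boolFunEquivFin (G.gates[j.1]'j.2).arity).symm a) <;> simp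

/-- **The consistency condition (6)**: if the consistency circuit is unsatisfiable then, at
every input, the claim for the output gate of `G` is `G(r)` (and the claim for every gate is its
true value). [cite: MurrayWilliams2018, §5 (proof of Thm. 1.1)] -/
theorem eval_eq_claim_output_of_not_satisfiable (hPin : ∀ (r : Fin ℓ → Bool) (i : Fin ℓ),
      (Pin i).1.eval (fun k => Sum.elim r id ((Pin i).2 k)) = r i)
    (hD : ¬ (Circuit.dnfOfLits (consistencyPats E σ Pin G)).Satisfiable)
    (r : Fin ℓ → Bool) {m : ℕ} (hout : G.output = .inr m) :
    G.eval r = claim E σ r m := by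
  have hm : m < G.size := G.wf_output m hout
  have h := (not_satisfiable_consistency_iff E σ Pin G hPin).1 hD r m hm
  rw [circuit_eval, hout, wireOf_inr, ← circuit_wireVals, List.getD_eq_getElem?_getD, h,
    Option.getD_some]

/-! ### The standard input-literal providers -/

/-- **The standard provider of input literals**: the gate-free circuit `Circuit.input k₀`
(`k₀ : Fin N`, so `N ≥ 1`) with its input `k₀` re-addressed to the input `i` of the evaluated
circuit and all other inputs to the constant `0`. [folklore] -/
def inputProvider (k₀ : Fin N) (i : Fin ℓ) : Circuit (Fin N) × (Fin N → Fin ℓ ⊕ Bool) :=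
  (Circuit.input k₀, fun k => if k = k₀ then Sum.inl i else Sum.inr false)

/-- The standard provider reads the input bit `r i`. [folklore] -/
theorem eval_inputProvider (k₀ : Fin N) (r : Fin ℓ → Bool) (i : Fin ℓ) :
    (inputProvider k₀ i).1.eval (fun k => Sum.elim r id ((inputProvider (ℓ := ℓ) k₀ i).2 k)) = r i := by
  simp [inputProvider]

/-- The standard provider has no gates, depth `0`, fan-in `0`, and is over every basis.
[folklore] -/
theorem inputProvider_bounds (k₀ : Fin N) (i : Fin ℓ) (B : Set GateFn) :
    (inputProvider (ℓ := ℓ) k₀ i).1.size = 0 ∧ (inputProvider (ℓ := ℓ) k₀ i).1.acDepth = 0 ∧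
      (inputProvider (ℓ := ℓ) k₀ i).1.maxFanIn = 0 ∧ (inputProvider (ℓ := ℓ) k₀ i).1.IsOver B :=
  ⟨rfl, rfl, rfl, fun g hg => by simp [inputProvider, Circuit.input] at hg⟩

/-- **The consistency condition with the standard input literals** (`N ≥ 1`): the circuit
`Circuit.dnfOfLits (consistencyPats E σ (inputProvider k₀) G)` is unsatisfiable iff every claim
of `E` about the gates of `G` is correct. [cite: MurrayWilliams2018, §5 (proof of Thm. 1.1)] -/
theorem not_satisfiable_consistency_inputProvider_iff (k₀ : Fin N) :
    ¬ (Circuit.dnfOfLits (consistencyPats E σ (inputProvider k₀) G)).Satisfiable ↔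
      ∀ (r : Fin ℓ → Bool) (j : ℕ), j < G.size → (G.wireVals r)[j]? = some (claim E σ r j) :=
  not_satisfiable_consistency_iff E σ (inputProvider k₀) G (eval_inputProvider k₀)

end EvalGate

end Literature.Computability.Complexity
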